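import Literature.NumberTheory.Sieve.Maynard2016Lemma93MainSum
import Literature.NumberTheory.Sieve.Maynard2016Lemma93Constants
import HarnessLib

/-!
# Maynard 2016, Lemma 9.3 — the analytic assembly ((9.26)–(9.30)) before the frame

Sources: J. Maynard, *Dense clusters of primes in subsets*, Compositio Math. 152 (2016) 1517–1554 =
arXiv:1405.2593 [Maynard2016DenseClusters], Lemma 9.3 (statement p. 22, display (9.14)) and its proof,
pp. 23–24 (displays (9.23)–(9.30)); K. Ford, B. Green, S. Konyagin, J. Maynard, T. Tao, *Long gaps between
primes*, JAMS 31 (2018) [FordGreenKonyaginMaynardTao2018], §7, Theorem 6 (7.13).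

This file assembles the exact skeleton (`FGKMT2018.yVarM_eq_main_add_err`), the main-term identification
(`FGKMT2018.mainM_eq_emSum`, `FGKMT2018.eulerProd_eq_emEuler_mul`), the `e_m`-summation
(`MaynardDense.emSummation`, display (9.29)), the quantitative (9.30) (`MaynardDense.abs_cGamma_mul_emEuler_sub_le'`),
the constants of `Maynard2016Lemma93Constants` and the error chain (`FGKMT2018.abs_errM_le`,
`MaynardDense.emSum_F₂_le`) into a two-sided estimate for `y^{(m)}_r` with every constant explicit and no
frame hypothesis beyond `k ≥ 2^18`, `R ≥ 2`, `⌊R⌋ + 1 > 2k²`, `⌊R⌋ + 1 ≥ 4k`: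

* §1 constants: `(W_m/φ(W_m))·(φ(M)/M) = φ(a_m WB ∏r)/(a_m WB ∏r)` for `M = a_m WB ∏r W_m` and
  `(∏r/φ_L(∏r))·P·(W_m/φ(W_m))·(φ(M)/M) = c_m` (`pref_mul_eq_cM`, display (9.30));
* §2 the size of `c_γ`: `emEuler M ω y ≥ e^{-1}` for `y > 2k²` (`inv_exp_le_emEuler`) and
  `c_γ(M) ≤ 2e·φ(M)/M` (`cGamma_emModulus_le`);
* §3 the estimate (`abs_yVarM_sub_le`):
  `|y^{(m)}_r − (log R) c_m ∫F dt_m| ≤ c_m·(E₁ + E₂ + E₃)` with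
  `E₁ = (4k/(⌊R⌋+1))·log R·∫F dt_m` ((9.30)),
  `E₂ = 2C₁(9 + ∑_{p∣M} log p/p)·31(1 + 30/U_k + T_k)·∏_{i≠m} g_k(uᵢ)` ((9.29), Lemma 8.3's error),
  `E₃ = 2e(30 + 30/U_k + T_k)·K_Δ·(∫F₂ dt_m + C₂(9 + ∑_{p∣M} log p/p)(16 + 30/U_k + T_k)F₂(u; u_m := 0)/log R)`
  ((9.26) and the first display of p. 24), `K_Δ` the constant of `FGKMT2018.sum_qBox_abs_sigmaM_log_le`.
  In the frame of [FGKMT, Thm 6] every bracket is `O(T_k (log log R)² ∫F₂ dt_m)` (the statement (9.14)).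

No new definitions, no named facts.

## References
* J. Maynard, *Dense clusters of primes in subsets*, Compositio Math. 152 (2016), Lemma 9.3 p. 22 (9.14) and
  its proof pp. 23–24, (9.23)–(9.30) [Maynard2016DenseClusters].
* K. Ford, B. Green, S. Konyagin, J. Maynard, T. Tao, *Long gaps between primes*, JAMS 31 (2018), §7,
  Thm 6 (7.13) [FordGreenKonyaginMaynardTao2018].
-/

noncomputable section

open Finset
open scoped Nat

namespace Literature.NumberTheory.Sieve

namespace FGKMT2018

variable {k : ℕ}

/-! ### §1 The constants of (9.30) -/

/-- `W_m` is coprime to `a_m · WB · M` (its primes avoid `WB`, `M`, `a_m` by definition).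
[cite: Maynard2016DenseClusters, proof of Lemma 9.3 p. 24, (9.28) («p ∣ W_m, p ∤ WBra_m»)] -/
theorem coprime_mstarProd (L : Fin k → ℤ × ℤ) (B N : ℕ) (m : Fin k) (M : ℕ) :
    Nat.Coprime ((L m).1.natAbs * (wCut k B * B) * M) (mstarProd L B N m M) := by
  refine Nat.Coprime.symm (Nat.coprime_of_dvd fun p hp hpW hpA => ?_)
  obtain ⟨-, hcop, hM, ha, -⟩ := (prime_dvd_mstarProd_iff L B N m M hp).1 hpW
  rcases hp.dvd_mul.1 hpA with h | h
  · rcases hp.dvd_mul.1 h with h' | h'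
    · exact ha h'
    · exact (Nat.Prime.coprime_iff_not_dvd hp).1 hcop h'
  · exact hM h

/-- `W_m ≠ 0`. [cite: Maynard2016DenseClusters, proof of Lemma 9.3 p. 24, (9.28)] -/
theorem mstarProd_ne_zero (L : Fin k → ℤ × ℤ) (B N : ℕ) (m : Fin k) (M : ℕ) :
    mstarProd L B N m M ≠ 0 := by
  unfold mstarProd
  exact Finset.prod_ne_zero_iff.2 fun p hp => (prime_of_mem_mstarSet hp).ne_zero

/-- `(W_m/φ(W_m)) · φ(a_m WB M W_m)/(a_m WB M W_m) = φ(a_m WB M)/(a_m WB M)` (for `a_m WB M ≠ 0`).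
[cite: Maynard2016DenseClusters, proof of Lemma 9.3 p. 24, (9.28)–(9.30) (the factor W_m/φ(W_m) against ∏_{p∣rW_m}(1 − 1/p))] -/
theorem mstar_div_mul_totient_emModulus_div (L : Fin k → ℤ × ℤ) (B N : ℕ) (m : Fin k) {M : ℕ}
    (h0 : (L m).1.natAbs * (wCut k B * B) * M ≠ 0) :
    ((mstarProd L B N m M : ℕ) : ℝ) / (Nat.totient (mstarProd L B N m M) : ℝ) *
        ((Nat.totient (emModulus L B N m M) : ℝ) / ((emModulus L B N m M : ℕ) : ℝ)) =
      (Nat.totient ((L m).1.natAbs * (wCut k B * B) * M) : ℝ) /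
        (((L m).1.natAbs * (wCut k B * B) * M : ℕ) : ℝ) := by
  have hW0 : mstarProd L B N m M ≠ 0 := mstarProd_ne_zero L B N m M
  have hφW : (Nat.totient (mstarProd L B N m M) : ℝ) ≠ 0 := by
    exact_mod_cast (Nat.totient_pos.2 (Nat.pos_of_ne_zero hW0)).ne'
  have hWr : ((mstarProd L B N m M : ℕ) : ℝ) ≠ 0 := by exact_mod_cast hW0
  have hA : (((L m).1.natAbs * (wCut k B * B) * M : ℕ) : ℝ) ≠ 0 := by exact_mod_cast h0
  unfold emModulus
  rw [Nat.totient_mul (coprime_mstarProd L B N m M)]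
  push_cast
  field_simp

/-- **The constant of (9.30)**: for `r ∈ 𝒟'^{(m)}_k` (`k ≥ 1`) and `M = a_m WB ∏r W_m`,
`(∏r/φ_L(∏r)) · P · (W_m/φ(W_m)) · φ(M)/M = c_m` (`P = (WB)^k𝔖_{WB}/φ(WB)^k`,
`c_m = φ(a_mWB)(WB)^{k−1}𝔖_{WB}/(a_m φ(WB)^k)`).
[cite: Maynard2016DenseClusters, proof of Lemma 9.3 p. 24, display (9.30)] -/
theorem pref_mul_eq_cM {L : Fin k → ℤ × ℤ} (hadm : FormsAdmissible L) (hk : 1 ≤ k) {B : ℕ}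
    (hB : B ≠ 0) {R : ℝ} {m : Fin k} {r : Fin k → ℕ} (hr : r ∈ dkBoxP L B R m) (N : ℕ) :
    ((∏ i, r i : ℕ) : ℝ) / totForm (L m) (∏ i, r i) * yPref L B *
        (((mstarProd L B N m (∏ i, r i) : ℕ) : ℝ) / (Nat.totient (mstarProd L B N m (∏ i, r i)) : ℝ)) *
        ((Nat.totient (emModulus L B N m (∏ i, r i)) : ℝ) / ((emModulus L B N m (∏ i, r i) : ℕ) : ℝ)) =
      cM L B m := by
  have hr1 : ∀ i, 1 ≤ r i := one_le_of_mem_dkBox (dkBoxP_subset L B R m hr)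
  have hprod0 : (∏ i, r i) ≠ 0 := Finset.prod_ne_zero_iff.2 fun i _ => Nat.one_le_iff_ne_zero.1 (hr1 i)
  have ha : (L m).1.natAbs ≠ 0 := Int.natAbs_ne_zero.2 (hadm.1 m)
  have hWB : wCut k B * B ≠ 0 := Nat.mul_ne_zero (wCut_pos k B).ne' hB
  have h0 : (L m).1.natAbs * (wCut k B * B) * ∏ i, r i ≠ 0 :=
    Nat.mul_ne_zero (Nat.mul_ne_zero ha hWB) hprod0
  rw [mul_assoc, mstar_div_mul_totient_emModulus_div L B N m h0, mul_comm _ (yPref L B), mul_assoc,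
    prod_div_totForm_mul_totient_div hr, cM_eq_yPref_mul hk]

/-! ### §2 The size of `c_γ` for the modulus of Lemma 9.3 -/

/-- Every prime `p ≤ 2k²` divides the modulus `a_m WB M W_m` (through `W·B`).
[cite: Maynard2016DenseClusters, §7 p. 13 (W), proof of Lemma 9.3 p. 24] -/
theorem dvd_emModulus_of_le (L : Fin k → ℤ × ℤ) (B N : ℕ) (m : Fin k) (M : ℕ) {p : ℕ} (hp : p.Prime)
    (hle : (p : ℝ) ≤ 2 * (k : ℝ) ^ 2) : p ∣ emModulus L B N m M := by
  have h := dvd_wCut_mul_of_le (k := k) (B := B) hp (by exact_mod_cast hle)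
  unfold emModulus
  exact (h.mul_left _).mul_right _ |>.mul_right _

/-- **`emEuler M ω y ≥ e^{-1}`** for `y > 2k²` when every prime `≤ 2k²` divides `M` and `ω ≤ k` off `M`:
the product below `2k² + 1` is empty and the tail product deviates from `1` by at most `e^{1/k} − 1` after
inversion (`MaynardDense.abs_inv_emEulerIco_sub_one_le`).
[cite: Maynard2016DenseClusters, proof of Lemma 9.3 p. 24, (9.28)–(9.30)] -/
theorem inv_exp_le_emEuler {M : ℕ} (hk : 2 ≤ k)
    (hsmall : ∀ p : ℕ, p.Prime → (p : ℝ) ≤ 2 * (k : ℝ) ^ 2 → p ∣ M) {ω : ℕ → ℕ}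
    (hω : ∀ p : ℕ, p.Prime → ω p < p) (hωK : ∀ p : ℕ, p.Prime → ¬p ∣ M → (ω p : ℝ) ≤ k)
    {y : ℕ} (hy : 2 * k ^ 2 + 1 ≤ y) :
    Real.exp (-1) ≤ MaynardDense.emEuler M ω y := by
  have hK₀ : (2 : ℝ) ≤ k := by exact_mod_cast hk
  -- the head product is empty
  have hhead : MaynardDense.emEuler M ω (2 * k ^ 2 + 1) = 1 := by
    unfold MaynardDense.emEuler
    refine Finset.prod_eq_one fun p hp => ?_
    exfalso
    obtain ⟨hp1, hp2⟩ := Finset.mem_filter.1 hp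
    obtain ⟨hlt, hpp⟩ := Nat.mem_primesBelow.1 hp1
    exact hp2 (hsmall p hpp (by exact_mod_cast Nat.lt_succ_iff.1 hlt))
  rw [MaynardDense.emEuler_eq_mul_emEulerIco M ω hy, hhead, one_mul]
  -- the tail
  have hy' : 2 * (k : ℝ) ^ 2 < ((2 * k ^ 2 + 1 : ℕ) : ℝ) := by push_cast; linarith
  have htail := MaynardDense.abs_inv_emEulerIco_sub_one_le (M := M) (Y := y) hK₀ hωK hy'
  have hexp : Real.exp (2 * (k : ℝ) / (((2 * k ^ 2 + 1 : ℕ) : ℝ) - 1)) ≤ Real.exp 1 := by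
    refine Real.exp_le_exp.2 ?_
    have hk0 : (0 : ℝ) < k := by linarith
    have : (((2 * k ^ 2 + 1 : ℕ) : ℝ) - 1) = 2 * (k : ℝ) ^ 2 := by push_cast; ring
    rw [this, div_le_one (by positivity)]
    nlinarith
  -- positivity of the tail product
  have hpos : 0 < MaynardDense.emEulerIco M ω (2 * k ^ 2 + 1) y := by
    unfold MaynardDense.emEulerIco
    exact Finset.prod_pos fun p hp => MaynardDense.emFactor_pos ω (Finset.mem_filter.1 hp).2.1
      (hω p (Finset.mem_filter.1 hp).2.1)
  have hinv : (MaynardDense.emEulerIco M ω (2 * k ^ 2 + 1) y)⁻¹ ≤ Real.exp 1 := by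
    have := (abs_le.1 htail).2
    linarith
  rw [Real.exp_neg, inv_le_comm₀ (Real.exp_pos 1) hpos]
  exact hinv

/-- **`c_γ(M) ≤ 2e·φ(M)/M`** for the modulus of Lemma 9.3 (`M ≠ 0` divisible by every prime `≤ 2k²`,
`ω(p) < p`, `ω ≤ k` off `M`), at any `y > 2k²` with `y ≥ 4k`: `c_γ·emEuler(y) ≤ (1 + 4k/y)φ(M)/M ≤ 2φ(M)/M`
(`MaynardDense.abs_cGamma_mul_emEuler_sub_le'`) and `emEuler(y) ≥ e^{-1}`.
[cite: Maynard2016DenseClusters, proof of Lemma 9.3 p. 24, (9.29)–(9.30)] -/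
theorem cGamma_le_of_modulus {M : ℕ} (hM : M ≠ 0) (hk : 2 ≤ k)
    (hsmall : ∀ p : ℕ, p.Prime → (p : ℝ) ≤ 2 * (k : ℝ) ^ 2 → p ∣ M) {ω : ℕ → ℕ}
    (hω : ∀ p : ℕ, p.Prime → ω p < p) (hωK : ∀ p : ℕ, p.Prime → ¬p ∣ M → (ω p : ℝ) ≤ k)
    {y : ℕ} (hy : 2 * k ^ 2 + 1 ≤ y) (hy4 : 4 * k ≤ y) :
    GGPY.cGamma (MaynardDense.emGamma M ω) ≤ 2 * Real.exp 1 * ((Nat.totient M : ℝ) / M) := by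
  have hK₀ : (2 : ℝ) ≤ k := by exact_mod_cast hk
  have hyr : 2 * (k : ℝ) ^ 2 < y := by exact_mod_cast (show 2 * k ^ 2 < y by omega)
  have h := MaynardDense.abs_cGamma_mul_emEuler_sub_le' hM hK₀ hsmall hωK (fun p hp _ => hω p hp) hyr
  have hE := inv_exp_le_emEuler hk hsmall hω hωK hy
  have hφ : 0 ≤ (Nat.totient M : ℝ) / M := by positivity
  have hy0 : (0 : ℝ) < y := by
    have : (1 : ℝ) ≤ y := by exact_mod_cast (show 1 ≤ y by nlinarith)
    linarith
  have h4 : 4 * (k : ℝ) / y ≤ 1 := by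
    rw [div_le_one hy0]; exact_mod_cast hy4
  have hce : GGPY.cGamma (MaynardDense.emGamma M ω) * MaynardDense.emEuler M ω y ≤
      2 * ((Nat.totient M : ℝ) / M) := by
    have := (abs_le.1 h).2
    nlinarith
  have hepos : 0 < MaynardDense.emEuler M ω y := lt_of_lt_of_le (Real.exp_pos _) hE
  have hc0 : 0 ≤ GGPY.cGamma (MaynardDense.emGamma M ω) :=
    (MaynardDense.cGamma_emGamma_pos hM hK₀ hsmall hωK).le
  -- `c ≤ 2φ/M / emEuler ≤ 2φ/M · e`
  have h1 : GGPY.cGamma (MaynardDense.emGamma M ω) ≤ 2 * ((Nat.totient M : ℝ) / M) / MaynardDense.emEuler M ω y := by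
    rw [le_div_iff₀ hepos]; exact hce
  refine h1.trans ?_
  rw [div_le_iff₀ hepos]
  have : Real.exp 1 * MaynardDense.emEuler M ω y ≥ 1 := by
    have h2 : Real.exp 1 * Real.exp (-1) = 1 := by rw [← Real.exp_add]; norm_num
    nlinarith [Real.exp_pos 1]
  nlinarith


/-! ### §3 The two-sided estimate for `y^{(m)}_r` (Lemma 9.3 before the frame) -/

/-- The modulus of Lemma 9.3 is non-zero. [cite: Maynard2016DenseClusters, proof of Lemma 9.3 p. 24, (9.29)] -/
theorem emModulus_ne_zero {L : Fin k → ℤ × ℤ} (hadm : FormsAdmissible L) {B : ℕ} (hB : B ≠ 0) (N : ℕ)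
    (m : Fin k) {M : ℕ} (hM : M ≠ 0) : emModulus L B N m M ≠ 0 := by
  unfold emModulus
  refine Nat.mul_ne_zero (Nat.mul_ne_zero (Nat.mul_ne_zero ?_ ?_) hM) (mstarProd_ne_zero L B N m M)
  · exact Int.natAbs_ne_zero.2 (hadm.1 m)
  · exact Nat.mul_ne_zero (wCut_pos k B).ne' hB

/-- **Maynard 2016, Lemma 9.3 assembled (before the frame bounds).** There are absolute `C₁, C₂ ≥ 0` such that
for `k ≥ 2^18`, admissible non-degenerate `𝓛`, `B ≠ 0`, `R ≥ 2` with `2k² ≤ ⌊R⌋` and `4k ≤ ⌊R⌋ + 1`, every `m`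
and every `r ∈ 𝒟'^{(m)}_k`, with `u = u(r)`, `M = a_m WB ∏r W_m`, `S_M = ∑_{p∣M} log p/p`,
`K_Δ = 2e⁶e^{2e⁶}∏_{p∣Δ*_m}(1+1/p)(1+∑_{p∣Δ*_m} log p/p)`:
`|y^{(m)}_r − (log R) c_m ∫₀^∞ F dt_m| ≤ c_m · ( (4k/(⌊R⌋+1))·log R·∫F dt_m`
`   + 2C₁(9 + S_M)·31(1 + 30/U_k + T_k)·∏_{i≠m} g_k(uᵢ)`
`   + 2e(30 + 30/U_k + T_k)·K_Δ·(∫F₂ dt_m + C₂(9 + S_M)(16 + 30/U_k + T_k) F₂(u; u_m := 0)/log R) )`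
— the three brackets are (9.30)'s `O(k/R)`, (9.29)'s Lemma 8.3 error, and (9.26)'s error; in the frame of
[FGKMT, Thm 6] each is `O(T_k (log log R)² ∫F₂ dt_m)`, which is the statement (9.14).
[cite: Maynard2016DenseClusters, Lemma 9.3 p. 22 (9.14), proof pp. 23–24 (9.26)–(9.30)] -/
theorem abs_yVarM_sub_le :
    ∃ C₁ C₂ : ℝ, 0 ≤ C₁ ∧ 0 ≤ C₂ ∧ ∀ (k : ℕ), 262144 ≤ k →
      ∀ (L : Fin k → ℤ × ℤ), FormsAdmissible L → FormsNondegenerate L →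
      ∀ (B : ℕ), B ≠ 0 → ∀ (R : ℝ), 2 ≤ R → 2 * k ^ 2 ≤ ⌊R⌋₊ → 4 * k ≤ ⌊R⌋₊ + 1 →
      ∀ (m : Fin k) (r : Fin k → ℕ), r ∈ dkBoxP L B R m →
        |yVarM L B R (MaynardDense.F k) m r -
            Real.log R * cM L B m * margInt m (MaynardDense.F k) (logVec R r)| ≤
          cM L B m *
            (4 * k / ((⌊R⌋₊ + 1 : ℕ) : ℝ) * Real.log R * margInt m (MaynardDense.F k) (logVec R r) +
              2 * C₁ * (9 + ∑ p ∈ (emModulus L B (primorial ⌊R⌋₊) m (∏ i, r i)).primeFactors,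
                  Real.log p / p) *
                (31 * (1 + 30 / MaynardDense.U k + MaynardDense.T k) *
                  ∏ i ∈ Finset.univ.erase m, MaynardDense.prof k (logVec R r i)) +
              2 * Real.exp 1 * (30 + 30 / MaynardDense.U k + MaynardDense.T k) *
                (2 * Real.exp 6 * Real.exp (2 * Real.exp 6) *
                  (∏ p ∈ (∏ j ∈ Finset.univ.erase m, (crossDet L m j).natAbs).primeFactors,
                    (1 + 1 / (p : ℝ))) *
                  (1 + ∑ p ∈ (∏ j ∈ Finset.univ.erase m, (crossDet L m j).natAbs).primeFactors,
                    Real.log p / p)) *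
                (margInt m (MaynardDense.F₂ k) (logVec R r) +
                  C₂ * (9 + ∑ p ∈ (emModulus L B (primorial ⌊R⌋₊) m (∏ i, r i)).primeFactors,
                    Real.log p / p) *
                    ((16 + 30 / MaynardDense.U k + MaynardDense.T k) *
                      MaynardDense.F₂ k (Function.update (logVec R r) m 0)) / Real.log R)) := by
  classical
  obtain ⟨C₁, hC₁⟩ := MaynardDense.emSummation
  obtain ⟨C₂, hC₂0, hC₂⟩ := MaynardDense.emSum_F₂_le
  refine ⟨max C₁ 0, C₂, le_max_right _ _, hC₂0, ?_⟩
  intro k hk L hadm hnd B hB R hR hRk hRk4 m r hr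
  have hC₁' : C₁ ≤ max C₁ 0 := le_max_left _ _
  have hC₁0 : 0 ≤ max C₁ 0 := le_max_right _ _
  set C₁' := max C₁ 0 with hC₁'def
  clear_value C₁'
  unfold margInt
  have hk2 : 2 ≤ k := le_trans (by norm_num) hk
  have hk1 : 1 ≤ k := le_trans (by norm_num) hk
  have hK₀ : (2 : ℝ) ≤ k := by exact_mod_cast hk2
  have hR1 : 1 < R := by linarith
  have hlogR : 0 < Real.log R := Real.log_pos hR1
  have hr1 : ∀ i, 1 ≤ r i := one_le_of_mem_dkBox (dkBoxP_subset L B R m hr)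
  have hprod0 : (∏ i, r i) ≠ 0 := Finset.prod_ne_zero_iff.2 fun i _ => Nat.one_le_iff_ne_zero.1 (hr1 i)
  have hM : emModulus L B (primorial ⌊R⌋₊) m (∏ i, r i) ≠ 0 := emModulus_ne_zero hadm hB _ m hprod0
  have hsmall : ∀ p : ℕ, p.Prime → (p : ℝ) ≤ 2 * (k : ℝ) ^ 2 →
      p ∣ emModulus L B (primorial ⌊R⌋₊) m (∏ i, r i) :=
    fun p hp hle => dvd_emModulus_of_le L B _ m _ hp hle
  have hω : ∀ p : ℕ, p.Prime → omegaL L p < p := ((formsAdmissible_iff_omegaL L).1 hadm).2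
  have hωK : ∀ p : ℕ, p.Prime → ¬ p ∣ emModulus L B (primorial ⌊R⌋₊) m (∏ i, r i) →
      ((omegaL L p : ℕ) : ℝ) ≤ (k : ℝ) := fun p hp _ => by exact_mod_cast omegaL_le_card_of_admissible hadm hp
  have hω' : ∀ p : ℕ, p.Prime → ¬ p ∣ emModulus L B (primorial ⌊R⌋₊) m (∏ i, r i) → omegaL L p < p :=
    fun p hp _ => hω p hp
  have hu : logVec R r ∈ MaynardDense.orthant k := logVec_mem_orthant hR1.le r hr1
  have hy : 2 * k ^ 2 + 1 ≤ ⌊R⌋₊ + 1 := by omega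
  have hyr : 2 * (k : ℝ) ^ 2 < ((⌊R⌋₊ + 1 : ℕ) : ℝ) := by exact_mod_cast (show 2 * k ^ 2 < ⌊R⌋₊ + 1 by omega)
  -- the pieces
  have hsplit := yVarM_eq_main_add_err hadm hR1 (MaynardDense.F k) hr
  have hmain := mainM_eq_emSum hadm hR1 hr
  have hP' := eulerProd_eq_emEuler_mul hadm B ⌊R⌋₊ m (∏ i, r i)
  have hem := hC₁ k hk2 _ hM (k : ℝ) hK₀ hsmall (omegaL L) hω hωK (logVec R r) m R hR
  have h930 := MaynardDense.abs_cGamma_mul_emEuler_sub_le' hM hK₀ hsmall hωK hω' hyr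
  have hconst := pref_mul_eq_cM hadm hk1 hB hr (primorial ⌊R⌋₊)
  have herr := abs_errM_le hadm hnd hk2 B hR1 hr
  have hF₂ := hC₂ k hk2 _ hM (k : ℝ) hK₀ hsmall (omegaL L) hω hωK (logVec R r) hu m R hR
  have hcle := cGamma_le_of_modulus hM hk2 hsmall hω hωK hy hRk4
  have hE := inv_exp_le_emEuler hk2 hsmall hω hωK hy
  -- name the atoms (all big expressions become opaque reals)
  set P'x := ∏ p ∈ (primorial ⌊R⌋₊).primeFactors,
      eulerFactorM L B m (∏ i, r i) (fun p j => sPrimeM L m j p / ((p : ℝ) - omegaL L p)) p with hP'xdef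
  set E := MaynardDense.emEuler (emModulus L B (primorial ⌊R⌋₊) m (∏ i, r i)) (omegaL L) (⌊R⌋₊ + 1)
    with hEdef
  set Wn := ((mstarProd L B (primorial ⌊R⌋₊) m (∏ i, r i) : ℕ) : ℝ) with hWndef
  set Wd := (Nat.totient (mstarProd L B (primorial ⌊R⌋₊) m (∏ i, r i)) : ℝ) with hWddef
  set φM := ((Nat.totient (emModulus L B (primorial ⌊R⌋₊) m (∏ i, r i)) : ℝ) /
      ((emModulus L B (primorial ⌊R⌋₊) m (∏ i, r i) : ℕ) : ℝ)) with hφMdef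
  set c := GGPY.cGamma (MaynardDense.emGamma (emModulus L B (primorial ⌊R⌋₊) m (∏ i, r i)) (omegaL L))
    with hcdef
  set IF := ∫ t in Set.Ici (0 : ℝ), MaynardDense.F k (Function.update (logVec R r) m t) with hIFdef
  set IF₂ := ∫ t in Set.Ici (0 : ℝ), MaynardDense.F₂ k (Function.update (logVec R r) m t) with hIF₂def
  set Pg := ∏ i ∈ Finset.univ.erase m, MaynardDense.prof k (logVec R r i) with hPgdef
  set S := ∑ p ∈ (emModulus L B (primorial ⌊R⌋₊) m (∏ i, r i)).primeFactors, Real.log p / p with hSdef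
  set eS := MaynardDense.emSum (emModulus L B (primorial ⌊R⌋₊) m (∏ i, r i)) (omegaL L)
      (fun t => MaynardDense.F k (Function.update (logVec R r) m t)) R with heSdef
  set eS₂ := MaynardDense.emSum (emModulus L B (primorial ⌊R⌋₊) m (∏ i, r i)) (omegaL L)
      (fun t => MaynardDense.F₂ k (Function.update (logVec R r) m t)) R with heS₂def
  set KΔ := 2 * Real.exp 6 * Real.exp (2 * Real.exp 6) *
      (∏ p ∈ (∏ j ∈ Finset.univ.erase m, (crossDet L m j).natAbs).primeFactors, (1 + 1 / (p : ℝ))) *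
      (1 + ∑ p ∈ (∏ j ∈ Finset.univ.erase m, (crossDet L m j).natAbs).primeFactors, Real.log p / p)
    with hKΔdef
  set c82 := (30 + 30 / MaynardDense.U k + MaynardDense.T k : ℝ) with hc82def
  set G := 31 * (1 + 30 / MaynardDense.U k + MaynardDense.T k) * Pg with hGdef
  set H := (16 + 30 / MaynardDense.U k + MaynardDense.T k) * MaynardDense.F₂ k (Function.update (logVec R r) m 0)
    with hHdef
  set P := yPref L B with hPdef
  set pref := ((∏ i, r i : ℕ) : ℝ) / totForm (L m) (∏ i, r i) with hprefdef
  set logR := Real.log R with hlogRdef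
  set yq := 4 * (k : ℝ) / ((⌊R⌋₊ + 1 : ℕ) : ℝ) with hyqdef
  set cMv := cM L B m with hcMvdef
  set ee := Real.exp 1 with heedef
  -- sign facts that need the definitions
  have hE0 : 0 < E := lt_of_lt_of_le (Real.exp_pos _) hE
  have hWd0 : 0 < Wd := by
    rw [hWddef]
    exact_mod_cast Nat.totient_pos.2 (Nat.pos_of_ne_zero (mstarProd_ne_zero L B _ m _))
  have hWnd : Wd ≤ Wn := by rw [hWddef, hWndef]; exact_mod_cast Nat.totient_le _
  have hφM0 : 0 < φM := by
    rw [hφMdef]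
    exact div_pos (by exact_mod_cast Nat.totient_pos.2 (Nat.pos_of_ne_zero hM))
      (by exact_mod_cast Nat.pos_of_ne_zero hM)
  have hc0 : 0 < c := by rw [hcdef]; exact MaynardDense.cGamma_emGamma_pos hM hK₀ hsmall hωK
  have hIF0 : 0 ≤ IF := by
    rw [hIFdef]
    exact MeasureTheory.setIntegral_nonneg measurableSet_Ici fun t ht =>
      MaynardDense.F_nonneg hk2 (MaynardDense.update_mem_orthant hu m ht)
  have hIF₂0 : 0 ≤ IF₂ := by
    rw [hIF₂def]
    exact MeasureTheory.setIntegral_nonneg measurableSet_Ici fun t ht =>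
      MaynardDense.F₂_nonneg hk2 (MaynardDense.update_mem_orthant hu m ht)
  have hPg0 : 0 ≤ Pg := by
    rw [hPgdef]
    exact Finset.prod_nonneg fun i _ => MaynardDense.prof_nonneg hk2 (MaynardDense.mem_orthant.1 hu i)
  have hS0 : 0 ≤ S := by
    rw [hSdef]
    exact Finset.sum_nonneg fun p hp => by
      have := (Nat.prime_of_mem_primeFactors hp).pos; positivity
  have hKΔ0 : 0 ≤ KΔ := by
    have h1 : 0 ≤ ∏ p ∈ (∏ j ∈ Finset.univ.erase m, (crossDet L m j).natAbs).primeFactors,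
        (1 + 1 / (p : ℝ)) := Finset.prod_nonneg fun p _ => by positivity
    have h2 : 0 ≤ ∑ p ∈ (∏ j ∈ Finset.univ.erase m, (crossDet L m j).natAbs).primeFactors,
        Real.log p / p := Finset.sum_nonneg fun p hp => by
      have hpP := Nat.prime_of_mem_primeFactors hp
      exact div_nonneg (Real.log_nonneg (by exact_mod_cast hpP.one_lt.le)) (by positivity)
    rw [hKΔdef]; positivity
  have hU := MaynardDense.U_pos hk1
  have hT := MaynardDense.T_pos hk2
  have hc820 : 0 ≤ c82 := by rw [hc82def]; positivity
  have hG0 : 0 ≤ G := by rw [hGdef]; positivity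
  have hH0 : 0 ≤ H := by
    rw [hHdef]
    exact mul_nonneg (by positivity)
      (MaynardDense.F₂_nonneg hk2 (MaynardDense.update_mem_orthant hu m le_rfl))
  have hP0 : 0 < P := by rw [hPdef]; unfold yPref; exact yPref_pos hadm hnd hk1 hB
  have hpref0 : 0 < pref := by
    rw [hprefdef]
    exact div_pos (by exact_mod_cast Nat.pos_of_ne_zero hprod0) (totForm_pos (L m) (hadm.1 m) hprod0)
  have hyq0 : 0 ≤ yq := by rw [hyqdef]; positivity
  have hyq1 : yq ≤ 1 := by
    rw [hyqdef, div_le_one (by positivity)]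
    exact_mod_cast hRk4
  have hee0 : 0 < ee := by rw [heedef]; exact Real.exp_pos 1
  -- the constant: `cM = pref · P · (Wn/Wd) · φM`
  have hcM : cMv = pref * P * (Wn / Wd) * φM := hconst.symm
  clear_value P'x E Wn Wd φM c IF IF₂ Pg S eS eS₂ KΔ c82 G H P pref logR yq cMv ee
  clear hP'xdef hEdef hWndef hWddef hφMdef hcdef hIFdef hIF₂def hPgdef hSdef heSdef heS₂def hKΔdef
    hc82def hPdef hprefdef hlogRdef hcMvdef hconst
  have hWf1 : 1 ≤ Wn / Wd := by rw [le_div_iff₀ hWd0, one_mul]; exact hWnd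
  have hWdne : Wd ≠ 0 := hWd0.ne'
  have hlogRne : logR ≠ 0 := hlogR.ne'
  have hQ0 : 0 ≤ pref * P * (Wn / Wd) := by positivity
  have hcM0 : 0 ≤ cMv := by rw [hcM]; positivity
  -- hide the three large hypotheses from the arithmetic tactics
  revert hsplit hmain herr
  -- MAIN (generic in the main expression)
  have hMAIN : ∀ Mx : ℝ, Mx = pref * P'x * P * eS →
      |Mx - logR * cMv * IF| ≤ cMv * (yq * logR * IF + 2 * C₁' * (9 + S) * G) := by
    intro Mx hMx
    rw [hMx, hP']
    have e1 : pref * (E * Wn / Wd) * P * eS - logR * cMv * IF =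
        pref * P * (Wn / Wd) * (E * (eS - c * logR * IF) + (c * E - φM) * (logR * IF)) := by
      rw [hcM]; field_simp; ring
    rw [e1, abs_mul, abs_of_nonneg hQ0]
    have hem' : |eS - c * logR * IF| ≤ C₁' * c * (9 + S) * G := by
      have h1 : |eS - c * logR * IF| ≤
          C₁ * c * (9 + S) * (31 * (1 + 30 / MaynardDense.U k + MaynardDense.T k) * |Pg|) := hem
      rw [abs_of_nonneg hPg0, ← hGdef] at h1
      refine h1.trans ?_
      have : 0 ≤ c * (9 + S) * G := by positivity
      have e : C₁ * c * (9 + S) * G = C₁ * (c * (9 + S) * G) := by ring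
      have e' : C₁' * c * (9 + S) * G = C₁' * (c * (9 + S) * G) := by ring
      rw [e, e']
      exact mul_le_mul_of_nonneg_right hC₁' this
    have h930' : |c * E - φM| ≤ yq * φM := h930
    have hcE : c * E ≤ (1 + yq) * φM := by
      have := (abs_le.1 h930').2; linarith only [this]
    have step1 : |E * (eS - c * logR * IF) + (c * E - φM) * (logR * IF)| ≤
        E * (C₁' * c * (9 + S) * G) + yq * φM * (logR * IF) := by
      refine (abs_add_le _ _).trans (add_le_add ?_ ?_)
      · rw [abs_mul, abs_of_pos hE0]
        exact mul_le_mul_of_nonneg_left hem' hE0.le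
      · rw [abs_mul, abs_of_nonneg (mul_nonneg hlogR.le hIF0)]
        exact mul_le_mul_of_nonneg_right h930' (mul_nonneg hlogR.le hIF0)
    have step2 : E * (C₁' * c * (9 + S) * G) + yq * φM * (logR * IF) ≤
        (1 + yq) * φM * (C₁' * (9 + S) * G) + yq * φM * (logR * IF) := by
      have h2 : 0 ≤ C₁' * (9 + S) * G := by positivity
      have key := mul_le_mul_of_nonneg_right hcE h2
      have e : E * (C₁' * c * (9 + S) * G) = c * E * (C₁' * (9 + S) * G) := by ring
      rw [e]
      linarith only [key]
    have step3 : (1 + yq) * φM * (C₁' * (9 + S) * G) ≤ 2 * φM * (C₁' * (9 + S) * G) := by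
      have h2 : 0 ≤ φM * (C₁' * (9 + S) * G) := by positivity
      have key := mul_le_mul_of_nonneg_right (show 1 + yq ≤ 2 by linarith only [hyq1]) h2
      have e : (1 + yq) * φM * (C₁' * (9 + S) * G) = (1 + yq) * (φM * (C₁' * (9 + S) * G)) := by ring
      have e' : 2 * φM * (C₁' * (9 + S) * G) = 2 * (φM * (C₁' * (9 + S) * G)) := by ring
      rw [e, e']
      exact key
    calc pref * P * (Wn / Wd) * |E * (eS - c * logR * IF) + (c * E - φM) * (logR * IF)|
        ≤ pref * P * (Wn / Wd) * (2 * φM * (C₁' * (9 + S) * G) + yq * φM * (logR * IF)) :=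
          mul_le_mul_of_nonneg_left (step1.trans (by linarith only [step2, step3])) hQ0
      _ = cMv * (yq * logR * IF + 2 * C₁' * (9 + S) * G) := by rw [hcM]; ring
  -- ERR (generic in the error expression)
  have hERR : ∀ Ex : ℝ, |Ex| ≤ c82 * |P| * KΔ / logR * pref * eS₂ →
      |Ex| ≤ cMv * (2 * ee * c82 * KΔ * (IF₂ + C₂ * (9 + S) * H / logR)) := by
    intro Ex h1
    rw [abs_of_pos hP0] at h1
    have h2 : eS₂ ≤ c * logR * IF₂ + C₂ * c * (9 + S) * H := hF₂
    have h3 : pref * P * c ≤ 2 * ee * cMv := by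
      have hcle' : c ≤ 2 * ee * φM := hcle
      have : pref * P * c ≤ pref * P * (2 * ee * φM) := mul_le_mul_of_nonneg_left hcle' (by positivity)
      refine this.trans ?_
      rw [hcM]
      have h4 : 0 ≤ pref * P * (2 * ee * φM) := by positivity
      have key := mul_le_mul_of_nonneg_left hWf1 h4
      calc pref * P * (2 * ee * φM) = pref * P * (2 * ee * φM) * 1 := by ring
        _ ≤ pref * P * (2 * ee * φM) * (Wn / Wd) := key
        _ = 2 * ee * (pref * P * (Wn / Wd) * φM) := by ring
    have hcoef : 0 ≤ c82 * P * KΔ / logR * pref := by positivity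
    calc |Ex| ≤ c82 * P * KΔ / logR * pref * eS₂ := h1
      _ ≤ c82 * P * KΔ / logR * pref * (c * logR * IF₂ + C₂ * c * (9 + S) * H) :=
          mul_le_mul_of_nonneg_left h2 hcoef
      _ = c82 * KΔ * (pref * P * c) * (IF₂ + C₂ * (9 + S) * H / logR) := by
          field_simp
      _ ≤ c82 * KΔ * (2 * ee * cMv) * (IF₂ + C₂ * (9 + S) * H / logR) := by
          have h5 : 0 ≤ IF₂ + C₂ * (9 + S) * H / logR := by positivity
          have h6 : 0 ≤ c82 * KΔ := by positivity
          exact mul_le_mul_of_nonneg_right (mul_le_mul_of_nonneg_left h3 h6) h5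
      _ = cMv * (2 * ee * c82 * KΔ * (IF₂ + C₂ * (9 + S) * H / logR)) := by ring
  -- total
  have hfin : ∀ Mx Ex : ℝ, Mx = pref * P'x * P * eS → |Ex| ≤ c82 * |P| * KΔ / logR * pref * eS₂ →
      |Mx + Ex - logR * cMv * IF| ≤
        cMv * (yq * logR * IF + 2 * C₁' * (9 + S) * G +
          2 * ee * c82 * KΔ * (IF₂ + C₂ * (9 + S) * H / logR)) := by
    intro Mx Ex hMx hEx
    have hA := hMAIN Mx hMx
    have hB := hERR Ex hEx
    have e : Mx + Ex - logR * cMv * IF = (Mx - logR * cMv * IF) + Ex := by ring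
    rw [e]
    refine (abs_add_le _ _).trans ?_
    have := add_le_add hA hB
    linarith only [this]
  intro hsplit hmain herr
  rw [hsplit]
  refine (hfin _ _ hmain herr).trans (le_of_eq ?_)
  rw [hGdef, hHdef, hyqdef, heedef]

end FGKMT2018

end Literature.NumberTheory.Sieve
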